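import Summits.QuantumFields.YangMills.Theorems.SwapVirialDeficitNearlyCommutingThreeFloor
import Summits.QuantumFields.YangMills.Theorems.SwapTwistDeficitToronFloorEvent
import HarnessLib

/-!
# The σ-TWISTED four-letter floor: `Haar⁴{C : SU(2)⁴ | relations of ℤ³ ⋊_σ ℤ up to t} ≥ c·t⁷` — the swap-central zero-mode block, NO logarithm
# (free-hands support of item stmt-QuantumFields-24197 `SwapVirialDeficit.SwapGluedStiffness`; brick (α1-σ) of LEAD ym-line-sfw-p2 g93's 05:57Z ruling,
# claimed by seat w2 g54 06:29Z after w3 g61's 06:27Z offer; consumer: w3 g61's σ-glued ring floor (α2-v) `c_L·e^{12βL⁴}·β^{−(9L⁴−1)} ≤ TT.twistTrace L β (2L)`)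

The fundamental group of the swap-glued three-torus (mapping torus of the coordinate swap `σ = (0 1)`) is `ℤ³ ⋊_σ ℤ = ⟨a, b, c, t | [a,b], [a,c], [b,c],
t a t⁻¹ = b, t b t⁻¹ = a, [t,c]⟩`.  For four Haar-random letters `C = (C 0, C 1, C 2, C 3) = (a, b, c, t)` of `SU(2)` read through their unit quaternions
`q = su2Quat`, the event that ALL these relations hold up to `t`,
`(∀ μ ν < 3, ‖q(C μ)q(C ν) − q(C ν)q(C μ)‖ ≤ t) ∧ (∀ μ < 3, ‖q(C 3)·q(C (σμ)) − q(C μ)·q(C 3)‖ ≤ t)`,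
has product-Haar mass at least `c·t⁷`: the letter `b = C 1` is SLAVED (`b ≈ t⁻¹ a t`, a chordal ball of mass `≍ t³`, ✓`ToronFloor.fdBallMass_ge`) and the
remaining three letters `(a, c, t) = (C 0, C 2, C 3)` pairwise nearly commute (mass `≍ t⁴`, ✓`NearlyCommutingThreeFloor.haar_pi_nearlyCommuting_three_ge`) —
the cone of commuting TRIPLES at a swap-central flat connection, RLCT `2`, multiplicity `1`: `β^{−7/2}` per zero-mode block against the periodic `β^{−3}·log β`
(seat w2 g54's stratum census SWAP-STRATA, line (C); evidence #2 on ⟨stmt-QuantumFields-23802⟩).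

* §1 `norm_comm_sub_comm_le`, `norm_comm_le_of_near`, ★ `sigma_relations` (pure quaternion algebra: `q₀, q₂, q₃` pairwise commuting up to `s` and
  `‖q₃q₁ − q₀q₃‖ ≤ s` ⟹ `[q₀,q₁], [q₁,q₂], q₃q₀ − q₁q₃` are `≤ 5s`), `mem_sigmaTwisted_of_inner` (the inner event at radius `s` lies in the σ-twisted event at `5s`);
* §2 `measurableSet_inner`, `haar_fdBall_mul_left`, ★ `measure_inner` — in the split coordinates `(C 1, (C 0, C 2, C 3))` (`piFinSuccAbove … 1`) the inner event
  `{triple nearly commuting at s} ∧ {fd (C 3·C 1) (C 0·C 3) ≤ r}` has mass EXACTLY `fdBallMass r · Haar³{triple nearly commuting at s}` (Fubini; the section over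
  each triple is a left-translated chordal ball);
* §3 `measurableSet_sigmaTwisted`, ★★ `haar_pi_sigmaTwisted_ge` — `∃ c > 0, ∃ t₀ > 0, ∀ t ∈ (0, t₀], c·t⁷ ≤ Haar⁴{σ-twisted event at t}` with
  `c = coneConst·c₃/(256·5⁷)`, `t₀ = 5·min(t₃, 1)` from the three-letter constants `(c₃, t₃)`.

Frobenius forms (`‖A − B‖_F = √2·‖q(A) − q(B)‖`, ✓`PeriodicRingFloor.frobNorm_comm_eq_sqrt_two_mul`) follow by rescaling `t`.
HONEST LABEL: a finite-dimensional Haar-volume lemma toward the fixed-`L` swap-floor prediction row `Z^S ≍ e^{12βL⁴}β^{−(9L⁴−1)}` (no log on the swap side);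
⟨24197⟩, ⟨24194⟩, ⟨24497⟩, ⟨24196⟩ stay OPEN; nothing about any crux or rung is proved; the Yang–Mills mass gap is NOT proved; no summit is proved by a line.
THEOREMS ONLY (0 `def`, 0 `sorry`), standard axioms.  Width seat ym-line-sfw-p2-w2 g54 (cell ym-idea-1, free hands), `--supports stmt-QuantumFields-24197`.
References: [cite: Luscher1983, §2]; [cite: Vanbaal2001]; [cite: GonzalezarroyoAltes1988]; [folklore].
-/

set_option autoImplicit false

noncomputable section

open MeasureTheory Quaternion Set
open scoped Quaternion ENNReal BigOperators
open Literature.MathematicalPhysics.QuantumLattice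
open Literature.MathematicalPhysics.QuantumFieldTheory (haarProbability)
open Summit.QuantumFields.YangMills.Theorems.SwapTwistDeficit.ToronLog

attribute [local instance] Literature.Analysis.FluidPDE.Tao2016.quatMeasurableSpace
  Literature.Analysis.FluidPDE.Tao2016.quatBorelSpace
  Literature.MathematicalPhysics.QuantumLattice.secondCountableTopology_su2

namespace Summit.QuantumFields.YangMills.Theorems.SwapVirialDeficit.SigmaTwistedLetterFloor

open Summit.QuantumFields.YangMills.Theorems.FemtoTransferGap (SU2)
open Summit.QuantumFields.YangMills.Theorems.SwapTwistDeficit.ToronFloor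
open Summit.QuantumFields.YangMills.Theorems.SwapVirialDeficit.NearlyCommutingThreeFloor
open Summit.QuantumFields.YangMills.Theorems.FemtoTransferGap.TwoLattice.Flat (fd fd_mul_left)
open Literature.MathematicalPhysics.QuantumFieldTheory.Balaban1983to89.T4HaarSU2Translate (su2Quat_mul su2Quat_one measurable_su2Quat)

/-! ## §1 Quaternion algebra: the slaved letter -/

/-- Moving the second argument of a commutator: `‖[a,b] − [a,c]‖ ≤ 2‖a‖·‖b − c‖`. [folklore] -/
theorem norm_comm_sub_comm_le (a b c : ℍ) : ‖(a * b - b * a) - (a * c - c * a)‖ ≤ 2 * ‖a‖ * ‖b - c‖ := by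
  have e : (a * b - b * a) - (a * c - c * a) = a * (b - c) - (b - c) * a := by
    simp only [mul_sub, sub_mul]; abel
  rw [e]
  calc ‖a * (b - c) - (b - c) * a‖ ≤ ‖a * (b - c)‖ + ‖(b - c) * a‖ := norm_sub_le _ _
    _ ≤ ‖a‖ * ‖b - c‖ + ‖b - c‖ * ‖a‖ := add_le_add (norm_mul_le _ _) (norm_mul_le _ _)
    _ = 2 * ‖a‖ * ‖b - c‖ := by ring

/-- `‖[a,b]‖ ≤ ‖[a,c]‖ + 2‖b − c‖` for a unit quaternion `a`. [folklore] -/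
theorem norm_comm_le_of_near {a b c : ℍ} (ha : ‖a‖ = 1) : ‖a * b - b * a‖ ≤ ‖a * c - c * a‖ + 2 * ‖b - c‖ := by
  have h := norm_comm_sub_comm_le a b c
  rw [ha, mul_one] at h
  have := norm_le_insert' (a * b - b * a) (a * c - c * a)
  -- `‖x‖ ≤ ‖y‖ + ‖x - y‖`
  have h2 : ‖a * b - b * a‖ ≤ ‖a * c - c * a‖ + ‖(a * b - b * a) - (a * c - c * a)‖ := norm_le_insert' _ _
  linarith

/-- **The slaved letter.**  Unit quaternions `q₀, q₂, q₃` pairwise commuting up to `s`, and `q₁` obeying the first `σ`-relation `‖q₃q₁ − q₀q₃‖ ≤ s`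
(i.e. `q₁` within `s` of `q₃⁻¹q₀q₃`): then ALL the relations of `ℤ³ ⋊_σ ℤ` hold up to `5s` — `q₀, q₁, q₂` pairwise commute up to `5s` and
`‖q₃q₀ − q₁q₃‖ ≤ 5s` (here `v = q₃⁻¹`). [folklore] -/
theorem sigma_relations {q₀ q₁ q₂ q₃ v : ℍ} (n0 : ‖q₀‖ = 1) (n2 : ‖q₂‖ = 1) (n3 : ‖q₃‖ = 1) (nv : ‖v‖ = 1)
    (hv3 : v * q₃ = 1) {s : ℝ} (hs : 0 ≤ s)
    (h02 : ‖q₀ * q₂ - q₂ * q₀‖ ≤ s) (h03 : ‖q₀ * q₃ - q₃ * q₀‖ ≤ s) (h1 : ‖q₃ * q₁ - q₀ * q₃‖ ≤ s) :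
    ‖q₀ * q₁ - q₁ * q₀‖ ≤ 5 * s ∧ ‖q₁ * q₂ - q₂ * q₁‖ ≤ 5 * s ∧ ‖q₃ * q₀ - q₁ * q₃‖ ≤ 5 * s := by
  -- the conjugate `p = q₃⁻¹ q₀ q₃` and its distance to `q₀` and to `q₁`
  set p : ℍ := v * q₀ * q₃ with hp
  have hpq0 : ‖p - q₀‖ ≤ s := by
    have e : p - q₀ = v * (q₀ * q₃ - q₃ * q₀) := by
      rw [hp, mul_sub, ← mul_assoc, ← mul_assoc, hv3, one_mul]
    rw [e, norm_mul, nv, one_mul]; exact h03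
  have hq1p : ‖q₁ - p‖ ≤ s := by
    have e : q₁ - p = v * (q₃ * q₁ - q₀ * q₃) := by
      rw [hp, mul_sub, ← mul_assoc, ← mul_assoc, hv3, one_mul]
    rw [e, norm_mul, nv, one_mul]; exact h1
  have hq1q0 : ‖q₁ - q₀‖ ≤ 2 * s := by
    have := norm_sub_le_norm_sub_add_norm_sub q₁ p q₀
    linarith
  refine ⟨?_, ?_, ?_⟩
  · -- `[q₀,q₁]` against `[q₀,q₀] = 0`
    have h := norm_comm_le_of_near (b := q₁) (c := q₀) n0
    rw [sub_self, norm_zero, zero_add] at h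
    linarith
  · -- `[q₁,q₂]` against `[q₀,q₂]`
    have h := norm_comm_le_of_near (b := q₁) (c := q₀) n2
    rw [norm_sub_rev (q₂ * q₀)] at h
    rw [norm_sub_rev]
    linarith
  · -- `q₃q₀ − q₁q₃ = (q₃q₀ − q₀q₃) + (q₀ − q₁)q₃`
    have e : q₃ * q₀ - q₁ * q₃ = (q₃ * q₀ - q₀ * q₃) + (q₀ - q₁) * q₃ := by
      simp only [sub_mul]; abel
    rw [e]
    calc ‖q₃ * q₀ - q₀ * q₃ + (q₀ - q₁) * q₃‖ ≤ ‖q₃ * q₀ - q₀ * q₃‖ + ‖(q₀ - q₁) * q₃‖ := norm_add_le _ _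
      _ = ‖q₀ * q₃ - q₃ * q₀‖ + ‖q₀ - q₁‖ := by rw [norm_sub_rev, norm_mul, n3, mul_one]
      _ ≤ s + 2 * s := add_le_add h03 (by rw [norm_sub_rev]; linarith [hq1q0, norm_sub_rev q₁ q₀])
      _ ≤ 5 * s := by linarith

/-- **The inner event implies the σ-twisted relations.**  For `C : Fin 4 → SU(2)` with `q(C 0), q(C 2), q(C 3)` pairwise commuting up to `s` and
`‖q(C 3)q(C 1) − q(C 0)q(C 3)‖ ≤ s`: the first three letters pairwise commute up to `5s` and the three `σ`-twisted seam relations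
`‖q(C 3)·q(C (σμ)) − q(C μ)·q(C 3)‖ ≤ 5s` (`σ = (0 1)`) hold. [folklore] -/
theorem mem_sigmaTwisted_of_inner {s : ℝ} (hs : 0 ≤ s) (C : Fin 4 → SU2)
    (hN : ∀ μ ν : Fin 3, ‖su2Quat (C (Fin.succAbove 1 μ)) * su2Quat (C (Fin.succAbove 1 ν)) -
      su2Quat (C (Fin.succAbove 1 ν)) * su2Quat (C (Fin.succAbove 1 μ))‖ ≤ s)
    (h1 : ‖su2Quat (C 3) * su2Quat (C 1) - su2Quat (C 0) * su2Quat (C 3)‖ ≤ s) :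
    (∀ μ ν : Fin 3, ‖su2Quat (C μ.castSucc) * su2Quat (C ν.castSucc) - su2Quat (C ν.castSucc) * su2Quat (C μ.castSucc)‖ ≤ 5 * s) ∧
      ∀ μ : Fin 3, ‖su2Quat (C (Fin.last 3)) * su2Quat (C (Equiv.swap (0 : Fin 3) 1 μ).castSucc) -
        su2Quat (C μ.castSucc) * su2Quat (C (Fin.last 3))‖ ≤ 5 * s := by
  have h02 : ‖su2Quat (C 0) * su2Quat (C 2) - su2Quat (C 2) * su2Quat (C 0)‖ ≤ s := hN 0 1
  have h20 : ‖su2Quat (C 2) * su2Quat (C 0) - su2Quat (C 0) * su2Quat (C 2)‖ ≤ s := hN 1 0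
  have h03 : ‖su2Quat (C 0) * su2Quat (C 3) - su2Quat (C 3) * su2Quat (C 0)‖ ≤ s := hN 0 2
  have h23 : ‖su2Quat (C 2) * su2Quat (C 3) - su2Quat (C 3) * su2Quat (C 2)‖ ≤ s := hN 1 2
  have h32 : ‖su2Quat (C 3) * su2Quat (C 2) - su2Quat (C 2) * su2Quat (C 3)‖ ≤ s := hN 2 1
  have hv3 : su2Quat (C 3)⁻¹ * su2Quat (C 3) = 1 := by rw [← su2Quat_mul, inv_mul_cancel, su2Quat_one]
  obtain ⟨hA, hB, hD⟩ := sigma_relations (norm_su2Quat (C 0)) (norm_su2Quat (C 2)) (norm_su2Quat (C 3)) (norm_su2Quat (C 3)⁻¹)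
    hv3 hs h02 h03 h1
  have hA' : ‖su2Quat (C 1) * su2Quat (C 0) - su2Quat (C 0) * su2Quat (C 1)‖ ≤ 5 * s := by rw [norm_sub_rev]; exact hA
  have hB' : ‖su2Quat (C 2) * su2Quat (C 1) - su2Quat (C 1) * su2Quat (C 2)‖ ≤ 5 * s := by rw [norm_sub_rev]; exact hB
  have hdiag : ∀ i : Fin 4, ‖su2Quat (C i) * su2Quat (C i) - su2Quat (C i) * su2Quat (C i)‖ ≤ 5 * s := by
    intro i; rw [sub_self, norm_zero]; positivity
  have h02' : ‖su2Quat (C 0) * su2Quat (C 2) - su2Quat (C 2) * su2Quat (C 0)‖ ≤ 5 * s := by linarith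
  have h20' : ‖su2Quat (C 2) * su2Quat (C 0) - su2Quat (C 0) * su2Quat (C 2)‖ ≤ 5 * s := by linarith
  have h1' : ‖su2Quat (C 3) * su2Quat (C 1) - su2Quat (C 0) * su2Quat (C 3)‖ ≤ 5 * s := by linarith
  have h32' : ‖su2Quat (C 3) * su2Quat (C 2) - su2Quat (C 2) * su2Quat (C 3)‖ ≤ 5 * s := by linarith
  refine ⟨fun μ ν => ?_, fun μ => ?_⟩
  · fin_cases μ <;> fin_cases ν
    · exact hdiag 0
    · exact hA
    · exact h02'
    · exact hA'
    · exact hdiag 1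
    · exact hB
    · exact h20'
    · exact hB'
    · exact hdiag 2
  · fin_cases μ
    · exact h1'
    · exact hD
    · exact h32'

/-! ## §2 The inner event and its product-Haar mass -/

/-- The inner event in split coordinates `(C 1, (C 0, C 2, C 3))`: the triple nearly commuting at `s`, and the first `σ`-relation at chordal radius `r`,
`fd (C 3 · C 1) (C 0 · C 3) ≤ r`. It is measurable. [folklore] -/
theorem measurableSet_inner (s r : ℝ) :
    MeasurableSet {p : SU2 × (Fin 3 → SU2) |
      (∀ μ ν : Fin 3, ‖su2Quat (p.2 μ) * su2Quat (p.2 ν) - su2Quat (p.2 ν) * su2Quat (p.2 μ)‖ ≤ s) ∧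
        fd (p.2 2 * p.1) (p.2 0 * p.2 2) ≤ r} := by
  have h1 : MeasurableSet {p : SU2 × (Fin 3 → SU2) |
      ∀ μ ν : Fin 3, ‖su2Quat (p.2 μ) * su2Quat (p.2 ν) - su2Quat (p.2 ν) * su2Quat (p.2 μ)‖ ≤ s} :=
    measurable_snd (measurableSet_nearlyCommuting_three s)
  have hf : Measurable fun p : SU2 × (Fin 3 → SU2) => p.2 2 * p.1 :=
    ((measurable_pi_apply 2).comp measurable_snd).mul measurable_fst
  have hg : Measurable fun p : SU2 × (Fin 3 → SU2) => p.2 0 * p.2 2 :=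
    ((measurable_pi_apply 0).comp measurable_snd).mul ((measurable_pi_apply 2).comp measurable_snd)
  have h2 : MeasurableSet {p : SU2 × (Fin 3 → SU2) | fd (p.2 2 * p.1) (p.2 0 * p.2 2) ≤ r} := measurableSet_fd_le hf hg r
  exact h1.inter h2

/-- A left-translated chordal ball `{u | fd (c·u) d ≤ r}` has Haar mass `fdBallMass r`. [folklore] -/
theorem haar_fdBall_mul_left (c d : SU2) (r : ℝ) : haarProbability SU2 {u : SU2 | fd (c * u) d ≤ r} = fdBallMass r := by
  have e : {u : SU2 | fd (c * u) d ≤ r} = {u : SU2 | fd u (c⁻¹ * d) ≤ r} := by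
    ext u
    simp only [Set.mem_setOf_eq]
    rw [← fd_mul_left c⁻¹ (c * u) d, inv_mul_cancel_left]
  rw [e, haar_fdBall_eq]

/-- **Mass of the inner event**: `fdBallMass r · Haar³{triple nearly commuting at s}` EXACTLY (Fubini over the slaved letter). [folklore] -/
theorem measure_inner (s r : ℝ) :
    ((haarProbability SU2).prod (Measure.pi fun _ : Fin 3 => haarProbability SU2))
        {p : SU2 × (Fin 3 → SU2) |
          (∀ μ ν : Fin 3, ‖su2Quat (p.2 μ) * su2Quat (p.2 ν) - su2Quat (p.2 ν) * su2Quat (p.2 μ)‖ ≤ s) ∧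
            fd (p.2 2 * p.1) (p.2 0 * p.2 2) ≤ r} =
      fdBallMass r * (Measure.pi fun _ : Fin 3 => haarProbability SU2)
        {a : Fin 3 → SU2 | ∀ μ ν : Fin 3, ‖su2Quat (a μ) * su2Quat (a ν) - su2Quat (a ν) * su2Quat (a μ)‖ ≤ s} := by
  set N : Set (Fin 3 → SU2) := {a | ∀ μ ν : Fin 3, ‖su2Quat (a μ) * su2Quat (a ν) - su2Quat (a ν) * su2Quat (a μ)‖ ≤ s} with hN
  have hNm : MeasurableSet N := measurableSet_nearlyCommuting_three s
  set P : Set (SU2 × (Fin 3 → SU2)) := {p | (∀ μ ν : Fin 3, ‖su2Quat (p.2 μ) * su2Quat (p.2 ν) - su2Quat (p.2 ν) * su2Quat (p.2 μ)‖ ≤ s) ∧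
    fd (p.2 2 * p.1) (p.2 0 * p.2 2) ≤ r} with hP
  have hPm : MeasurableSet P := measurableSet_inner s r
  rw [Measure.prod_apply_symm hPm]
  have hsec : ∀ a : Fin 3 → SU2, haarProbability SU2 ((fun u : SU2 => (u, a)) ⁻¹' P) = N.indicator (fun _ => fdBallMass r) a := by
    intro a
    by_cases ha : a ∈ N
    · rw [Set.indicator_of_mem ha]
      have ha' : ∀ μ ν : Fin 3, ‖su2Quat (a μ) * su2Quat (a ν) - su2Quat (a ν) * su2Quat (a μ)‖ ≤ s := ha
      have e : (fun u : SU2 => (u, a)) ⁻¹' P = {u : SU2 | fd (a 2 * u) (a 0 * a 2) ≤ r} := by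
        ext u; simp [hP, ha']
      rw [e, haar_fdBall_mul_left]
    · rw [Set.indicator_of_notMem ha]
      have ha' : ¬ ∀ μ ν : Fin 3, ‖su2Quat (a μ) * su2Quat (a ν) - su2Quat (a ν) * su2Quat (a μ)‖ ≤ s := ha
      have e : (fun u : SU2 => (u, a)) ⁻¹' P = ∅ := by
        ext u; simp [hP, ha']
      rw [e, measure_empty]
  simp_rw [hsec]
  rw [lintegral_indicator_const hNm]

/-! ## §3 The σ-twisted four-letter floor -/

/-- The `σ`-twisted four-letter event is measurable. [folklore] -/
theorem measurableSet_sigmaTwisted (t : ℝ) :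
    MeasurableSet {C : Fin 4 → SU2 |
      (∀ μ ν : Fin 3, ‖su2Quat (C μ.castSucc) * su2Quat (C ν.castSucc) - su2Quat (C ν.castSucc) * su2Quat (C μ.castSucc)‖ ≤ t) ∧
        ∀ μ : Fin 3, ‖su2Quat (C (Fin.last 3)) * su2Quat (C (Equiv.swap (0 : Fin 3) 1 μ).castSucc) -
          su2Quat (C μ.castSucc) * su2Quat (C (Fin.last 3))‖ ≤ t} := by
  have hq : ∀ i : Fin 4, Measurable fun C : Fin 4 → SU2 => su2Quat (C i) := fun i => measurable_su2Quat.comp (measurable_pi_apply i)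
  have h1 : MeasurableSet {C : Fin 4 → SU2 |
      ∀ μ ν : Fin 3, ‖su2Quat (C μ.castSucc) * su2Quat (C ν.castSucc) - su2Quat (C ν.castSucc) * su2Quat (C μ.castSucc)‖ ≤ t} := by
    rw [Set.setOf_forall]
    refine MeasurableSet.iInter fun μ => ?_
    rw [Set.setOf_forall]
    exact MeasurableSet.iInter fun ν => measurableSet_le (((hq _).mul (hq _)).sub ((hq _).mul (hq _))).norm measurable_const
  have h2 : MeasurableSet {C : Fin 4 → SU2 | ∀ μ : Fin 3, ‖su2Quat (C (Fin.last 3)) * su2Quat (C (Equiv.swap (0 : Fin 3) 1 μ).castSucc) -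
      su2Quat (C μ.castSucc) * su2Quat (C (Fin.last 3))‖ ≤ t} := by
    rw [Set.setOf_forall]
    exact MeasurableSet.iInter fun μ => measurableSet_le (((hq _).mul (hq _)).sub ((hq _).mul (hq _))).norm measurable_const
  exact h1.inter h2

/-- ★ **THE σ-TWISTED FOUR-LETTER FLOOR.**  There are `c > 0` and `t₀ > 0` such that for `0 < t ≤ t₀` the product Haar measure of the quadruples
`C ∈ SU(2)⁴` satisfying, up to `t` in the unit quaternions, the relations of `π₁ = ℤ³ ⋊_σ ℤ` of the swap-glued three-torus — `C 0, C 1, C 2` pairwise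
commuting and the seam letter `C 3` intertwining `C (σμ)` with `C μ`, `σ = (0 1)` — is at least `c·t⁷`: the three-letter floor `≍ t⁴` for
`(C 0, C 2, C 3)` (✓`haar_pi_nearlyCommuting_three_ge`) times a chordal ball `≍ t³` for the slaved letter `C 1 ≈ C 3⁻¹·C 0·C 3` (✓`fdBallMass_ge`),
at inner radius `t/5` (✓`mem_sigmaTwisted_of_inner`).  The swap-central zero-mode block of the σ-glued femto ring: exponent `(9 − 5)/2·… = 7/2` per
`√β`, i.e. `β^{−7/2}` against the periodic `β^{−3}·log β` — no logarithm on the swap side. [folklore] -/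
theorem haar_pi_sigmaTwisted_ge :
    ∃ c : ℝ, 0 < c ∧ ∃ t₀ : ℝ, 0 < t₀ ∧ ∀ t : ℝ, 0 < t → t ≤ t₀ →
      c * t ^ 7 ≤
        (Measure.pi fun _ : Fin 4 => haarProbability SU2).real {C : Fin 4 → SU2 |
          (∀ μ ν : Fin 3, ‖su2Quat (C μ.castSucc) * su2Quat (C ν.castSucc) - su2Quat (C ν.castSucc) * su2Quat (C μ.castSucc)‖ ≤ t) ∧
            ∀ μ : Fin 3, ‖su2Quat (C (Fin.last 3)) * su2Quat (C (Equiv.swap (0 : Fin 3) 1 μ).castSucc) -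
              su2Quat (C μ.castSucc) * su2Quat (C (Fin.last 3))‖ ≤ t} := by
  obtain ⟨c₃, hc₃, t₃, ht₃, h3⟩ := haar_pi_nearlyCommuting_three_ge
  refine ⟨coneConst / 256 * c₃ / 5 ^ 7, by have := coneConst_pos; positivity, 5 * min t₃ 1, by positivity,
    fun t ht ht₀ => ?_⟩
  -- the inner radius
  set s : ℝ := t / 5 with hsdef
  have hs0 : 0 < s := by positivity
  have hs3 : s ≤ t₃ := by rw [hsdef]; linarith [min_le_left t₃ 1]
  have hs1 : s ≤ 1 := by rw [hsdef]; linarith [min_le_right t₃ 1]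
  have hts : 5 * s = t := by rw [hsdef]; ring
  -- the events
  set E : Set (Fin 4 → SU2) := {C |
    (∀ μ ν : Fin 3, ‖su2Quat (C μ.castSucc) * su2Quat (C ν.castSucc) - su2Quat (C ν.castSucc) * su2Quat (C μ.castSucc)‖ ≤ t) ∧
      ∀ μ : Fin 3, ‖su2Quat (C (Fin.last 3)) * su2Quat (C (Equiv.swap (0 : Fin 3) 1 μ).castSucc) -
        su2Quat (C μ.castSucc) * su2Quat (C (Fin.last 3))‖ ≤ t} with hE
  set N : Set (Fin 3 → SU2) := {a | ∀ μ ν : Fin 3, ‖su2Quat (a μ) * su2Quat (a ν) - su2Quat (a ν) * su2Quat (a μ)‖ ≤ s} with hN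
  set P : Set (SU2 × (Fin 3 → SU2)) := {p | (∀ μ ν : Fin 3, ‖su2Quat (p.2 μ) * su2Quat (p.2 ν) - su2Quat (p.2 ν) * su2Quat (p.2 μ)‖ ≤ s) ∧
    fd (p.2 2 * p.1) (p.2 0 * p.2 2) ≤ s} with hP
  have hPm : MeasurableSet P := measurableSet_inner s s
  set e := MeasurableEquiv.piFinSuccAbove (fun _ : Fin 4 => SU2) 1 with he
  have hpres := measurePreserving_piFinSuccAbove (fun _ : Fin 4 => haarProbability SU2) 1
  -- the inner event lies in `E`
  have hsub : e ⁻¹' P ⊆ E := by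
    intro C hC
    have hC' : (∀ μ ν : Fin 3, ‖su2Quat (C (Fin.succAbove 1 μ)) * su2Quat (C (Fin.succAbove 1 ν)) -
        su2Quat (C (Fin.succAbove 1 ν)) * su2Quat (C (Fin.succAbove 1 μ))‖ ≤ s) ∧ fd (C 3 * C 1) (C 0 * C 3) ≤ s := hC
    have h1 : ‖su2Quat (C 3) * su2Quat (C 1) - su2Quat (C 0) * su2Quat (C 3)‖ ≤ s := by
      have h := ((fd_le_iff (C 3 * C 1) (C 0 * C 3) s).1 hC'.2).2
      rw [su2Quat_mul, su2Quat_mul] at h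
      have hn := norm_nonneg (su2Quat (C 3) * su2Quat (C 1) - su2Quat (C 0) * su2Quat (C 3))
      nlinarith
    have hm := mem_sigmaTwisted_of_inner hs0.le C hC'.1 h1
    rw [hts] at hm
    exact hm
  -- measures
  have hmain : fdBallMass s * (Measure.pi fun _ : Fin 3 => haarProbability SU2) N ≤ (Measure.pi fun _ : Fin 4 => haarProbability SU2) E := by
    rw [← measure_inner s s, ← hpres.measure_preimage hPm.nullMeasurableSet]
    exact measure_mono hsub
  have hball := fdBallMass_ge hs0 hs1
  have hthree : ENNReal.ofReal (c₃ * s ^ 4) ≤ (Measure.pi fun _ : Fin 3 => haarProbability SU2) N := by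
    rw [ENNReal.ofReal_le_iff_le_toReal (measure_ne_top _ _)]
    exact h3 s hs0 hs3
  have hfin : (Measure.pi fun _ : Fin 4 => haarProbability SU2) E ≠ ∞ := measure_ne_top _ _
  have hprod : ENNReal.ofReal (coneConst * (s ^ 3 / 256) * (c₃ * s ^ 4)) ≤ (Measure.pi fun _ : Fin 4 => haarProbability SU2) E := by
    rw [ENNReal.ofReal_mul (by have := coneConst_pos; positivity)]
    exact le_trans (mul_le_mul' hball hthree) hmain
  have hreal : coneConst * (s ^ 3 / 256) * (c₃ * s ^ 4) ≤ ((Measure.pi fun _ : Fin 4 => haarProbability SU2) E).toReal := by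
    rw [← ENNReal.ofReal_le_iff_le_toReal hfin]
    exact hprod
  show _ ≤ ((Measure.pi fun _ : Fin 4 => haarProbability SU2) E).toReal
  refine le_trans (le_of_eq ?_) hreal
  rw [hsdef]
  ring

end Summit.QuantumFields.YangMills.Theorems.SwapVirialDeficit.SigmaTwistedLetterFloor

end
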